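import Literature.Analysis.UnboundedOperators.HeatKernel
import HarnessLib

/-!
# `Lᵖ → L^q` smoothing of the heat semigroup (discharge)

Sibling proof file of `HeatKernel.lean` (D-0014: named facts `def X : Prop` are discharged as
`theorem X_holds : X`). It discharges

* `Literature.eLpNorm_heatExtension_le_rpow_holds : Literature.eLpNorm_heatExtension_le_rpow E F` — the
  `Lᵖ → L^q` estimate for the Gauss–Weierstrass semigroup `e^{tΔ} f = heatKernel t ⋆ f`:
  `‖e^{tΔ} f‖_q ≤ C t^{-(n/2)(1/p - 1/q)} ‖f‖_p` for `0 < t`, `1 ≤ p ≤ q ≤ ∞`, `n = finrank ℝ E`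
  (Giga–Giga–Saal, *Nonlinear Partial Differential Equations* (2010), §1.1.2–§1.1.3, the
  `Lᵖ`–`L^q` estimates for the heat semigroup; the same statement, with an unspecified constant
  exactly as vendored, is Robinson–Rodrigo–Sadowski, *The Three-Dimensional Navier–Stokes
  Equations* (2016), Appendix D.2, Theorem D.4, eq. (D.6): *for any `1 ≤ l ≤ r ≤ ∞` we have,
  for `t > 0`, `‖e^{tΔ}f‖_{L^r} ≤ C t^{-(n/2)(1/l-1/r)} ‖f‖_{L^l}`*, proved there as "a simple
  application of Young's inequality for convolutions". The Young / interpolation proof yields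
  the explicit constant `(4πt)^{-(n/2)(1/p-1/q)}`, while the vendored fact only asks for some
  `C = C(E, p, q)`; the proof below gives `C = 1` since `(4π)^{-(n/2)(1/p-1/q)} ≤ 1`).

Proof (the textbook route, all in `ℝ≥0∞`):

* interpolation between `Lᵖ` and `L^∞`: `‖g‖_q ≤ ‖g‖_p^{p/q} ‖g‖_∞^{1-p/q}` for `0 < p ≤ q ≤ ∞`
  (`Literature.Analysis.UnboundedOperators.eLpNorm_le_eLpNorm_rpow_mul_eLpNorm_top_rpow`, from `∫ ‖g‖^q ≤ ‖g‖_∞^{q-p} ∫ ‖g‖^p`);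
* Hölder applied pointwise to a convolution on a group with a left- and negation-invariant measure:
  `‖K ⋆ f‖_∞ ≤ ‖K‖_{p'} ‖f‖_p` for conjugate exponents (`Literature.Analysis.UnboundedOperators.eLpNorm_top_convolution_lsmul_le`);
* the kernel bounds `heatKernel t ≤ (4πt)^{-n/2}` (`Literature.Analysis.UnboundedOperators.heatKernel_le`, in `HeatKernel.lean`)
  and `‖heatKernel t‖₁ = 1` (`Literature.Analysis.UnboundedOperators.lintegral_enorm_heatKernel`), interpolated to
  `‖heatKernel t‖_r ≤ ((4πt)^{-n/2})^{1-1/r}` for `1 ≤ r ≤ ∞` (`Literature.Analysis.UnboundedOperators.eLpNorm_heatKernel_le`);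
* hence the endpoint `‖e^{tΔ} f‖_∞ ≤ (4πt)^{-n/(2p)} ‖f‖_p` (`Literature.Analysis.UnboundedOperators.eLpNorm_top_heatExtension_le`),
  which interpolated against the `Lᵖ` contraction `‖e^{tΔ} f‖_p ≤ ‖f‖_p`
  (`Literature.Analysis.UnboundedOperators.eLpNorm_heatExtension_le_holds`, Young) gives
  `‖e^{tΔ} f‖_q ≤ (4πt)^{-(n/2)(1/p-1/q)} ‖f‖_p ≤ t^{-(n/2)(1/p-1/q)} ‖f‖_p`.

## References

* M.-H. Giga, Y. Giga, J. Saal, *Nonlinear Partial Differential Equations. Asymptotic Behavior of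
  Solutions and Self-Similar Solutions*, Birkhäuser (2010), §1.1.2–§1.1.3. [GigaGigaSaal2010]
* J. C. Robinson, J. L. Rodrigo, W. Sadowski, *The Three-Dimensional Navier–Stokes Equations.
  Classical Theory*, Cambridge University Press (2016), Appendix D.2, Theorem D.4 (p. 395).
  [RobinsonRodrigoSadowski2016]
-/

open MeasureTheory Filter Topology
open scoped Real ENNReal NNReal Convolution

namespace Literature.Analysis.UnboundedOperators

/-! ### Interpolation between `Lᵖ` and `L^∞` -/

section Interpolation

variable {α : Type*} [MeasurableSpace α] {μ : Measure α} {F : Type*} [NormedAddCommGroup F]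

/-- `∫ ‖f‖^q ≤ ‖f‖_∞^(q-p) ∫ ‖f‖^p` for `0 ≤ p ≤ q`. [folklore] -/
theorem lintegral_rpow_enorm_le_eLpNormEssSup_rpow_mul {f : α → F} (hf : AEStronglyMeasurable f μ)
    {p q : ℝ} (hp : 0 ≤ p) (hpq : p ≤ q) :
    ∫⁻ x, ‖f x‖ₑ ^ q ∂μ ≤ eLpNormEssSup f μ ^ (q - p) * ∫⁻ x, ‖f x‖ₑ ^ p ∂μ := by
  calc ∫⁻ x, ‖f x‖ₑ ^ q ∂μ = ∫⁻ x, ‖f x‖ₑ ^ (q - p) * ‖f x‖ₑ ^ p ∂μ := by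
        refine lintegral_congr fun x => ?_
        rw [← ENNReal.rpow_add_of_nonneg _ _ (sub_nonneg.2 hpq) hp, sub_add_cancel]
    _ ≤ ∫⁻ x, eLpNormEssSup f μ ^ (q - p) * ‖f x‖ₑ ^ p ∂μ := by
        apply lintegral_mono_ae
        filter_upwards [enorm_ae_le_eLpNormEssSup f μ] with x hx
        gcongr
    _ = eLpNormEssSup f μ ^ (q - p) * ∫⁻ x, ‖f x‖ₑ ^ p ∂μ :=
        lintegral_const_mul'' _ (hf.enorm.pow_const _)

/-- **Interpolation between `Lᵖ` and `L^∞`**: for `0 < p ≤ q ≤ ∞`,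
`‖f‖_q ≤ ‖f‖_p^(p/q) ‖f‖_∞^(1 - p/q)` (exponents realised through `ENNReal.toReal`, so that
`p/q = 0` when `q = ∞`). [folklore] -/
theorem eLpNorm_le_eLpNorm_rpow_mul_eLpNorm_top_rpow {f : α → F} (hf : AEStronglyMeasurable f μ)
    {p q : ℝ≥0∞} (hp : p ≠ 0) (hpq : p ≤ q) :
    eLpNorm f q μ ≤ eLpNorm f p μ ^ (p.toReal / q.toReal) *
      eLpNorm f ∞ μ ^ (1 - p.toReal / q.toReal) := by
  rcases eq_or_ne q ∞ with rfl | hq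
  · simp
  have hp' : p ≠ ∞ := ne_top_of_le_ne_top hq hpq
  have hq0 : q ≠ 0 := (lt_of_lt_of_le (pos_iff_ne_zero.2 hp) hpq).ne'
  have ha : 0 < p.toReal := ENNReal.toReal_pos hp hp'
  have hb : 0 < q.toReal := ENNReal.toReal_pos hq0 hq
  have hab : p.toReal ≤ q.toReal := (ENNReal.toReal_le_toReal hp' hq).2 hpq
  rw [eLpNorm_eq_lintegral_rpow_enorm_toReal hp hp', eLpNorm_eq_lintegral_rpow_enorm_toReal hq0 hq,
    eLpNorm_exponent_top]
  calc (∫⁻ x, ‖f x‖ₑ ^ q.toReal ∂μ) ^ (1 / q.toReal)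
      ≤ (eLpNormEssSup f μ ^ (q.toReal - p.toReal) * ∫⁻ x, ‖f x‖ₑ ^ p.toReal ∂μ) ^ (1 / q.toReal) :=
        ENNReal.rpow_le_rpow (lintegral_rpow_enorm_le_eLpNormEssSup_rpow_mul hf ha.le hab)
          (by positivity)
    _ = ((∫⁻ x, ‖f x‖ₑ ^ p.toReal ∂μ) ^ (1 / p.toReal)) ^ (p.toReal / q.toReal) *
          eLpNormEssSup f μ ^ (1 - p.toReal / q.toReal) := by
        rw [ENNReal.mul_rpow_of_nonneg _ _ (by positivity), ← ENNReal.rpow_mul, ← ENNReal.rpow_mul,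
          mul_comm]
        congr 2
        · field_simp
        · field_simp

end Interpolation

/-! ### Pointwise Hölder bound for convolutions -/

section HolderPointwise

variable {G : Type*} [MeasurableSpace G] [AddGroup G] {μ : Measure G}
  {F : Type*} [NormedAddCommGroup F] [NormedSpace ℝ F]
  [MeasurableAdd₂ G] [MeasurableNeg G] [μ.IsAddLeftInvariant] [μ.IsNegInvariant]

/-- Hölder's inequality applied pointwise to a convolution: `‖(K ⋆ f) x‖ ≤ ‖K‖_p ‖f‖_q` for
conjugate exponents `1/p + 1/q = 1` (left-invariant, negation-invariant measure). [folklore] -/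
theorem enorm_convolution_lsmul_le_eLpNorm_mul_eLpNorm {K : G → ℝ} (hK : AEStronglyMeasurable K μ)
    {f : G → F} (hf : AEStronglyMeasurable f μ) (p q : ℝ≥0∞) [p.HolderConjugate q] (x : G) :
    ‖(K ⋆[ContinuousLinearMap.lsmul ℝ ℝ, μ] f) x‖ₑ ≤ eLpNorm K p μ * eLpNorm f q μ := by
  have hmp : MeasurePreserving (fun y => x - y) μ μ := Measure.measurePreserving_sub_left μ x
  have hg : AEStronglyMeasurable (fun y => f (x - y)) μ := hf.comp_measurePreserving hmp
  calc ‖(K ⋆[ContinuousLinearMap.lsmul ℝ ℝ, μ] f) x‖ₑ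
      ≤ ∫⁻ y, ‖K y‖ₑ * ‖f (x - y)‖ₑ ∂μ := enorm_convolution_lsmul_le K f x
    _ = eLpNorm (K • fun y => f (x - y)) 1 μ := by
        rw [eLpNorm_one_eq_lintegral_enorm]
        simp_rw [Pi.smul_apply', enorm_smul]
    _ ≤ eLpNorm K p μ * eLpNorm (fun y => f (x - y)) q μ := eLpNorm_smul_le_mul_eLpNorm hg hK
    _ = eLpNorm K p μ * eLpNorm f q μ := by
        rw [show (fun y => f (x - y)) = f ∘ (fun y => x - y) from rfl,
          eLpNorm_comp_measurePreserving hf hmp]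

/-- `L^p → L^∞` bound for convolutions: `‖K ⋆ f‖_∞ ≤ ‖K‖_p ‖f‖_q` for conjugate exponents.
[folklore] -/
theorem eLpNorm_top_convolution_lsmul_le {K : G → ℝ} (hK : AEStronglyMeasurable K μ)
    {f : G → F} (hf : AEStronglyMeasurable f μ) (p q : ℝ≥0∞) [p.HolderConjugate q] :
    eLpNorm (K ⋆[ContinuousLinearMap.lsmul ℝ ℝ, μ] f) ∞ μ ≤ eLpNorm K p μ * eLpNorm f q μ := by
  rw [eLpNorm_exponent_top]
  exact eLpNormEssSup_le_of_ae_enorm_bound (Eventually.of_forall fun x =>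
    enorm_convolution_lsmul_le_eLpNorm_mul_eLpNorm hK hf p q x)

end HolderPointwise

/-! ### `Lʳ` norms of the heat kernel and the `Lᵖ → L^q` estimate -/

section Smoothing

variable {E : Type*} [NormedAddCommGroup E] [InnerProductSpace ℝ E]

/-- Sup bound for the heat kernel in `ℝ≥0∞`: `‖heatKernel t x‖ₑ ≤ (4πt)^{-n/2}` for `0 < t`
(the Gaussian factor is `≤ 1`; the real-valued form is `Literature.Analysis.UnboundedOperators.heatKernel_le` in `HeatKernel.lean`).
[folklore] -/
theorem enorm_heatKernel_le {t : ℝ} (ht : 0 < t) (x : E) :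
    ‖heatKernel t x‖ₑ ≤ ENNReal.ofReal ((4 * π * t) ^ (-(Module.finrank ℝ E : ℝ) / 2)) := by
  rw [Real.enorm_eq_ofReal (heatKernel_pos ht x).le]
  refine ENNReal.ofReal_le_ofReal ?_
  unfold heatKernel
  refine mul_le_of_le_one_right (by positivity) ?_
  rw [Real.exp_le_one_iff, neg_div]
  have : 0 ≤ ‖x‖ ^ 2 / (4 * t) := by positivity
  linarith

variable [FiniteDimensional ℝ E] [MeasurableSpace E] [BorelSpace E]

/-- `Lʳ` bound for the heat kernel, `1 ≤ r ≤ ∞`: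
`‖heatKernel t‖_r ≤ ((4πt)^{-n/2})^{1 - 1/r}` (from `‖heatKernel t‖₁ = 1`, the sup bound and
interpolation); cf. Giga–Giga–Saal, *Nonlinear PDEs*, §1.1.2–§1.1.3. [folklore] -/
theorem eLpNorm_heatKernel_le {t : ℝ} (ht : 0 < t) {r : ℝ≥0∞} (hr : 1 ≤ r) :
    eLpNorm (heatKernel (E := E) t) r volume ≤
      ENNReal.ofReal ((4 * π * t) ^ (-(Module.finrank ℝ E : ℝ) / 2)) ^ (1 - r⁻¹).toReal := by
  have hK : AEStronglyMeasurable (heatKernel (E := E) t) volume :=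
    (continuous_heatKernel t).aestronglyMeasurable
  have h1 : eLpNorm (heatKernel (E := E) t) 1 volume = 1 := by
    rw [eLpNorm_one_eq_lintegral_enorm, lintegral_enorm_heatKernel ht]
  have hexp : (1 - r⁻¹).toReal = 1 - (1 : ℝ≥0∞).toReal / r.toReal := by
    rw [ENNReal.toReal_sub_of_le (ENNReal.inv_le_one.2 hr) ENNReal.one_ne_top, ENNReal.toReal_inv,
      ENNReal.toReal_one, one_div]
  calc eLpNorm (heatKernel (E := E) t) r volume
      ≤ eLpNorm (heatKernel (E := E) t) 1 volume ^ ((1 : ℝ≥0∞).toReal / r.toReal) *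
          eLpNorm (heatKernel (E := E) t) ∞ volume ^ (1 - (1 : ℝ≥0∞).toReal / r.toReal) :=
        eLpNorm_le_eLpNorm_rpow_mul_eLpNorm_top_rpow hK one_ne_zero hr
    _ ≤ ENNReal.ofReal ((4 * π * t) ^ (-(Module.finrank ℝ E : ℝ) / 2)) ^ (1 - r⁻¹).toReal := by
        rw [h1, ENNReal.one_rpow, one_mul, hexp, eLpNorm_exponent_top]
        refine ENNReal.rpow_le_rpow (eLpNormEssSup_le_of_ae_enorm_bound
          (Eventually.of_forall (enorm_heatKernel_le ht))) ?_
        rw [ENNReal.toReal_one, sub_nonneg]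
        rcases eq_or_ne r ∞ with rfl | hr'
        · simp
        · rw [div_le_one (ENNReal.toReal_pos (one_pos.trans_le hr).ne' hr')]
          simpa using (ENNReal.toReal_le_toReal ENNReal.one_ne_top hr').2 hr

variable {F : Type*} [NormedAddCommGroup F] [NormedSpace ℝ F]

/-- `Lᵖ → L^∞` estimate for the heat semigroup: `‖e^{tΔ} f‖_∞ ≤ (4πt)^{-n/(2p)} ‖f‖_p`,
`1 ≤ p ≤ ∞` (Hölder + the `L^{p'}` bound for the kernel); cf. Giga–Giga–Saal, *Nonlinear PDEs*,
§1.1.2–§1.1.3. [folklore] -/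
theorem eLpNorm_top_heatExtension_le {f : E → F} (hf : AEStronglyMeasurable f volume) {p : ℝ≥0∞}
    (hp : 1 ≤ p) {t : ℝ} (ht : 0 < t) :
    eLpNorm (heatExtension f t) ∞ volume ≤
      ENNReal.ofReal ((4 * π * t) ^ (-(Module.finrank ℝ E : ℝ) / 2)) ^ p⁻¹.toReal *
        eLpNorm f p volume := by
  haveI : p.HolderConjugate p.conjExponent := .conjExponent hp
  have hK : AEStronglyMeasurable (heatKernel (E := E) t) volume :=
    (continuous_heatKernel t).aestronglyMeasurable
  calc eLpNorm (heatExtension f t) ∞ volume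
      ≤ eLpNorm (heatKernel t) p.conjExponent volume * eLpNorm f p volume :=
        eLpNorm_top_convolution_lsmul_le hK hf p.conjExponent p
    _ ≤ _ := by
        gcongr
        rw [← ENNReal.HolderConjugate.one_sub_inv p.conjExponent p]
        exact eLpNorm_heatKernel_le ht (ENNReal.HolderConjugate.one_le p.conjExponent p)

/-- Exponent bookkeeping for the `Lᵖ → L^q` estimate:
`(1/p) (1 - p/q) = 1/p - 1/q` in the `ENNReal.toReal` realisation (`1/∞ = 0`). [folklore] -/
theorem toReal_inv_mul_one_sub_div {p q : ℝ≥0∞} (hp : p ≠ 0) (hpq : p ≤ q) :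
    p⁻¹.toReal * (1 - p.toReal / q.toReal) = (1 / p).toReal - (1 / q).toReal := by
  rcases eq_or_ne q ∞ with rfl | hq
  · simp
  have hp' : p ≠ ∞ := ne_top_of_le_ne_top hq hpq
  have hq0 : q ≠ 0 := (lt_of_lt_of_le (pos_iff_ne_zero.2 hp) hpq).ne'
  have ha : 0 < p.toReal := ENNReal.toReal_pos hp hp'
  have hb : 0 < q.toReal := ENNReal.toReal_pos hq0 hq
  simp only [one_div, ENNReal.toReal_inv]
  field_simp

variable (E F) in
/-- Discharge of `eLpNorm_heatExtension_le_rpow`: `‖e^{tΔ} f‖_q ≤ C t^{-(n/2)(1/p-1/q)} ‖f‖_p`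
for `1 ≤ p ≤ q ≤ ∞`, `0 < t`, here with constant `C = 1` (the proof gives the sharper constant
`(4π)^{-(n/2)(1/p-1/q)} ≤ 1`): interpolate between the `Lᵖ` contraction `‖e^{tΔ}f‖_p ≤ ‖f‖_p`
and the `Lᵖ → L^∞` bound `‖e^{tΔ}f‖_∞ ≤ (4πt)^{-n/(2p)}‖f‖_p`. Giga–Giga–Saal, *Nonlinear PDEs*,
§1.1.2–§1.1.3; Robinson–Rodrigo–Sadowski, *The Three-Dimensional Navier–Stokes Equations*,
Appendix D.2, Theorem D.4, eq. (D.6) (p. 395): for `1 ≤ l ≤ r ≤ ∞` and `t > 0`,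
`‖e^{tΔ}f‖_{L^r} ≤ C t^{-(n/2)(1/l-1/r)} ‖f‖_{L^l}`, "a simple application of Young's inequality
for convolutions". [cite: GigaGigaSaal2010, §1.1.3]
[cite: RobinsonRodrigoSadowski2016, App. D.2 Thm. D.4 eq. (D.6) p. 395] -/
theorem eLpNorm_heatExtension_le_rpow_holds : eLpNorm_heatExtension_le_rpow E F := by
  intro _ p q hp hpq
  refine ⟨1, fun f hf t ht => ?_⟩
  set n : ℝ := (Module.finrank ℝ E : ℝ) with hn
  have hp0 : p ≠ 0 := (zero_lt_one.trans_le hp).ne'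
  have hg : AEStronglyMeasurable (heatExtension f t) volume :=
    (memLp_heatExtension_holds hf hp ht).1
  set θ : ℝ := p.toReal / q.toReal with hθ
  have hq0 : q ≠ 0 := (lt_of_lt_of_le (pos_iff_ne_zero.2 hp0) hpq).ne'
  have hθ0 : 0 ≤ θ := by positivity
  have hθ1 : θ ≤ 1 := by
    rcases eq_or_ne q ∞ with rfl | hq
    · simp [hθ]
    · rw [hθ, div_le_one (ENNReal.toReal_pos hq0 hq)]
      exact (ENNReal.toReal_le_toReal (ne_top_of_le_ne_top hq hpq) hq).2 hpq
  set A : ℝ≥0∞ := ENNReal.ofReal ((4 * π * t) ^ (-n / 2)) with hA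
  have hAt : 0 < (4 * π * t) ^ (-n / 2) := Real.rpow_pos_of_pos (by positivity) _
  -- the two endpoint estimates
  have h1 : eLpNorm (heatExtension f t) p volume ≤ eLpNorm f p volume :=
    eLpNorm_heatExtension_le_holds hf hp ht
  have h2 : eLpNorm (heatExtension f t) ∞ volume ≤ A ^ p⁻¹.toReal * eLpNorm f p volume :=
    eLpNorm_top_heatExtension_le hf.1 hp ht
  -- interpolate
  calc eLpNorm (heatExtension f t) q volume
      ≤ eLpNorm (heatExtension f t) p volume ^ θ * eLpNorm (heatExtension f t) ∞ volume ^ (1 - θ) :=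
        eLpNorm_le_eLpNorm_rpow_mul_eLpNorm_top_rpow hg hp0 hpq
    _ ≤ eLpNorm f p volume ^ θ * (A ^ p⁻¹.toReal * eLpNorm f p volume) ^ (1 - θ) :=
        mul_le_mul' (ENNReal.rpow_le_rpow h1 hθ0) (ENNReal.rpow_le_rpow h2 (by linarith))
    _ = A ^ (p⁻¹.toReal * (1 - θ)) * eLpNorm f p volume := by
        rw [ENNReal.mul_rpow_of_nonneg _ _ (by linarith), ← ENNReal.rpow_mul, mul_left_comm,
          ← ENNReal.rpow_add_of_nonneg _ _ hθ0 (by linarith), add_sub_cancel, ENNReal.rpow_one,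
          mul_comm]
    _ ≤ (1 : ℝ≥0) * ENNReal.ofReal (t ^ (-(n / 2) * ((1 / p).toReal - (1 / q).toReal))) *
          eLpNorm f p volume := by
        rw [ENNReal.coe_one, one_mul, toReal_inv_mul_one_sub_div hp0 hpq]
        gcongr
        set s : ℝ := (1 / p).toReal - (1 / q).toReal with hs
        have hs0 : 0 ≤ s := by
          rw [hs, sub_nonneg]
          exact ENNReal.toReal_mono (by simpa using hp0)
            (by simpa [one_div] using ENNReal.inv_le_inv.2 hpq)
        rw [hA, ENNReal.ofReal_rpow_of_pos hAt, ← Real.rpow_mul (by positivity),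
          Real.mul_rpow (by positivity) ht.le]
        refine ENNReal.ofReal_le_ofReal ?_
        calc (4 * π) ^ (-n / 2 * s) * t ^ (-n / 2 * s) ≤ 1 * t ^ (-n / 2 * s) := by
              gcongr
              refine Real.rpow_le_one_of_one_le_of_nonpos ?_ ?_
              · have := Real.two_le_pi; linarith
              · have : 0 ≤ n := by positivity
                nlinarith
          _ = t ^ (-(n / 2) * s) := by rw [one_mul, neg_div]

end Smoothing

end Literature.Analysis.UnboundedOperators
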